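import Mathlib.Tactic

/-!
# The aggregate covector law of the generic one-type universe (pub-hsemireg, W2 seat w2-t1-1, gen 23)

Kernel transcription of the PEN COROLLARIES (§4) of THEOREM (41-C+) of the record memo
`widen/W2/w2t11/SYMLAW-w2t11g23.md`.  LINEAGE SIDE (not formalised; symbolic ×1 by
`symlaw/symproof.py`, output sha256/16 recorded in the memo; text-level on every LIVE census row of
record): for a generic member class `τ = (τ0, τ1)` of `ℤ[ω]²`, pencil `j`, weight pair `W`, the
aggregate covector of the one-type-per-pencil live system is `C(W) = n_a Γ_a + n_b Γ_b` with the
n-law weights and `a_of(j, C(W)) = n_a g₁ + n_b g₂`, `g₁ = conj (τ0 - τ1, τ0)`, `g₂ = conj (-τ1, τ0 - τ1)`.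
WHAT IS CHECKED HERE (explicit polynomial statements, no definitions).  Conjugation is modelled by
independent variables: `t0 t1` stand for `τ0 τ1` and `T0 T1` for their conjugates, so that
`N(τ0) = t0 * T0`, `det(τ, conj τ) = t0 * T1 - t1 * T0` (`= y √-3`) and
`A := N(τ0) + N(τ1) + N(τ0 - τ1) = 2 (t0 T0 + t1 T1) - (t0 T1 + T0 t1)`.
* `det_g1`, `det_g2`: `det(τ, g₁) = N τ0 + N τ1 - conj(τ0) τ1 =: δ`, `det(τ, g₂) = conj δ`;
  `det_g1_add_det_g2 : δ + conj δ = A`, `det_g1_sub_det_g2 : δ - conj δ = det(τ, conj τ)`;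
* `det_aP`: the diagonal vector `a_P = g₁ + g₂ = conj (τ0 - 2 τ1, 2 τ0 - τ1)` has `det(τ, a_P) = A`;
* `content_*`: the Bezout identities showing `(τ0 - 2τ1, 2τ0 - τ1) = (τ0 + τ1, 3)` as ideals when
  `u τ0 + v τ1 = 1` (primitive class), whence `N(τ, c″) = A² / N(gcd(τ0 + τ1, 3))`;
* `detDiag_sub_one`: on the diagonal `det(w) = A (N - (3w - A)²) / (3 w N)` satisfies
  `det(w) - 1 = (A - 3w) (3 A w - A² + N) / (3 w N)`; `detDiag_ge_one_iff`: for `0 < w`, `0 < N`,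
  `det(w) ≥ 1 ↔ 0 ≤ (A - 3 w) (3 A w - A² + N)` (the (SC) window `A/4 + 3y²/(4A) ≤ w ≤ A/3` when
  `N = (A² - 9 y²)/4`, lemma `window_iff`).
RECORD ONLY; W2 counts 0 ∕ 0 ∕ 0 unchanged.  Honest framing: nothing here says HC / HC_CM / HC_AV
is proved.
-/

namespace Summit.Ventures.HSemireg.AggregateCovectorLaw

variable {R : Type*} [CommRing R]
variable {F : Type*} [Field F] [LinearOrder F] [IsStrictOrderedRing F]

/-! ## The two pencil vectors `g₁ = (T0 - T1, T0)`, `g₂ = (-T1, T0 - T1)` and the diagonal vector -/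

/-- `det(τ, g₁) = τ0 · T0 - τ1 · (T0 - T1) = N τ0 + N τ1 - T0 τ1` (`= δ = (A + y√-3)/2`). -/
theorem det_g1 (t0 t1 T0 T1 : R) :
    t0 * T0 - t1 * (T0 - T1) = t0 * T0 + t1 * T1 - T0 * t1 := by
  ring

/-- `det(τ, g₂) = τ0 · (T0 - T1) - τ1 · (-T1) = N τ0 + N τ1 - τ0 T1` (`= conj δ`). -/
theorem det_g2 (t0 t1 T0 T1 : R) :
    t0 * (T0 - T1) - t1 * (-T1) = t0 * T0 + t1 * T1 - t0 * T1 := by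
  ring

/-- `δ + conj δ = A = N τ0 + N τ1 + N (τ0 - τ1)`. -/
theorem det_g1_add_det_g2 (t0 t1 T0 T1 : R) :
    (t0 * T0 + t1 * T1 - T0 * t1) + (t0 * T0 + t1 * T1 - t0 * T1)
      = t0 * T0 + t1 * T1 + (t0 - t1) * (T0 - T1) := by
  ring

/-- `δ - conj δ = det(τ, conj τ) = τ0 T1 - τ1 T0` (`= y √-3`), i.e. `g₁ - g₂ = conj τ`. -/
theorem det_g1_sub_det_g2 (t0 t1 T0 T1 : R) :
    (t0 * T0 + t1 * T1 - T0 * t1) - (t0 * T0 + t1 * T1 - t0 * T1) = t0 * T1 - t1 * T0 := by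
  ring

/-- `g₁ + g₂ = (T0 - 2 T1, 2 T0 - T1) = conj (τ0 - 2 τ1, 2 τ0 - τ1)` componentwise. -/
theorem g1_add_g2 (T0 T1 : R) :
    (T0 - T1) + (-T1) = T0 - 2 * T1 ∧ T0 + (T0 - T1) = 2 * T0 - T1 := by
  constructor <;> ring

/-- `det(τ, a_P) = A` for the diagonal vector `a_P = (T0 - 2 T1, 2 T0 - T1)`. -/
theorem det_aP (t0 t1 T0 T1 : R) :
    t0 * (2 * T0 - T1) - t1 * (T0 - 2 * T1) = t0 * T0 + t1 * T1 + (t0 - t1) * (T0 - T1) := by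
  ring

/-- `4 N(Δ) = A² + 3 det(τ, conj τ)²` is `A² - 9 y²` when `det(τ, conj τ)² = -3 y²`
(`det(τ, conj τ) = y (ω - conj ω)`, `(ω - conj ω)² = -3`). -/
theorem four_NDelta (A D y : R) (hD : D ^ 2 = -3 * y ^ 2) :
    A ^ 2 + 3 * D ^ 2 = A ^ 2 - 9 * y ^ 2 := by
  rw [hD]; ring

/-! ## The content ideal `(τ0 - 2 τ1, 2 τ0 - τ1) = (τ0 + τ1, 3)` of a primitive class -/

/-- `τ0 - 2 τ1 ∈ (τ0 + τ1, 3)`. -/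
theorem content_fwd₁ (t0 t1 : R) : t0 - 2 * t1 = (t0 + t1) - 3 * t1 := by ring

/-- `2 τ0 - τ1 ∈ (τ0 + τ1, 3)`. -/
theorem content_fwd₂ (t0 t1 : R) : 2 * t0 - t1 = 2 * (t0 + t1) - 3 * t1 := by ring

/-- `τ0 + τ1 ∈ (τ0 - 2 τ1, 2 τ0 - τ1)`. -/
theorem content_bwd₁ (t0 t1 : R) : t0 + t1 = (2 * t0 - t1) - (t0 - 2 * t1) := by ring

/-- `3 τ0, 3 τ1 ∈ (τ0 - 2 τ1, 2 τ0 - τ1)`. -/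
theorem content_bwd₂ (t0 t1 : R) :
    3 * t0 = 2 * (2 * t0 - t1) - (t0 - 2 * t1) ∧ 3 * t1 = (2 * t0 - t1) - 2 * (t0 - 2 * t1) := by
  constructor <;> ring

/-- `3 ∈ (τ0 - 2 τ1, 2 τ0 - τ1)` for a PRIMITIVE class (`u τ0 + v τ1 = 1`): explicit Bezout witness,
so the two ideals coincide and the content of `a_P` divides `3` (norm `3^v ∈ {1, 3, 9}`). -/
theorem content_bwd₃ (t0 t1 u v : R) (h : u * t0 + v * t1 = 1) :
    (3 : R) = (2 * u + v) * (2 * t0 - t1) + (-u - 2 * v) * (t0 - 2 * t1) := by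
  linear_combination (-3 : R) * h

/-! ## The diagonal determinant and the (SC) window -/

/-- On the diagonal cell `(w, w)`: `det(w) - 1 = (A - 3w)(3Aw - A² + N) / (3 w N)` for
`det(w) = A (N - (3w - A)²) / (3 w N)` (`N = N(Δ)`). -/
theorem detDiag_sub_one {K : Type*} [Field K] [CharZero K] (A N w : K) (hw : w ≠ 0) (hN : N ≠ 0) :
    A * (N - (3 * w - A) ^ 2) / (3 * w * N) - 1
      = (A - 3 * w) * (3 * A * w - A ^ 2 + N) / (3 * w * N) := by
  have h3 : (3 : K) * w * N ≠ 0 := by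
    have : (3 : K) ≠ 0 := by norm_num
    exact mul_ne_zero (mul_ne_zero this hw) hN
  field_simp
  ring

/-- `det(w) ≥ 1 ↔ 0 ≤ (A - 3w)(3Aw - A² + N)` for `0 < w`, `0 < N`. -/
theorem detDiag_ge_one_iff (A N w : F) (hw : 0 < w) (hN : 0 < N) :
    1 ≤ A * (N - (3 * w - A) ^ 2) / (3 * w * N) ↔ 0 ≤ (A - 3 * w) * (3 * A * w - A ^ 2 + N) := by
  have hd : (0 : F) < 3 * w * N := by positivity
  rw [← sub_nonneg, detDiag_sub_one A N w hw.ne' hN.ne', le_div_iff₀ hd, zero_mul]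

/-- The second factor: `3Aw - A² + N = 3A (w - (A/4 + 3y²/(4A)))` when `4N = A² - 9y²`, `A ≠ 0`. -/
theorem secondFactor_eq {K : Type*} [Field K] [CharZero K] (A N w y : K) (hA : A ≠ 0) (hN : 4 * N = A ^ 2 - 9 * y ^ 2) :
    3 * A * w - A ^ 2 + N = 3 * A * (w - (A / 4 + 3 * y ^ 2 / (4 * A))) := by
  have hN' : N = (A ^ 2 - 9 * y ^ 2) / 4 := by
    field_simp; linear_combination hN
  rw [hN']
  field_simp
  ring

/-- THE (SC) WINDOW.  For `0 < A`, `0 < w` and `4N = A² - 9y² > 0`: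
`0 ≤ (A - 3w)(3Aw - A² + N) ↔ A/4 + 3y²/(4A) ≤ w ≤ A/3`. -/
theorem window_iff (A N w y : F) (hA : 0 < A) (hN : 4 * N = A ^ 2 - 9 * y ^ 2) (hNpos : 0 < N) :
    0 ≤ (A - 3 * w) * (3 * A * w - A ^ 2 + N)
      ↔ A / 4 + 3 * y ^ 2 / (4 * A) ≤ w ∧ w ≤ A / 3 := by
  have hlo : A / 4 + 3 * y ^ 2 / (4 * A) < A / 3 := by
    rw [div_add_div _ _ (by norm_num : (4 : F) ≠ 0) (by positivity : (4 : F) * A ≠ 0),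
      div_lt_div_iff₀ (by positivity) (by norm_num)]
    nlinarith [hN, hNpos, sq_nonneg y]
  rw [secondFactor_eq A N w y hA.ne' hN]
  set lo := A / 4 + 3 * y ^ 2 / (4 * A) with hlo_def
  constructor
  · intro h
    have h' : 0 ≤ (A - 3 * w) * (w - lo) := by
      have : (A - 3 * w) * (3 * A * (w - lo)) = (3 * A) * ((A - 3 * w) * (w - lo)) := by ring
      rw [this] at h
      exact nonneg_of_mul_nonneg_right (by simpa [mul_comm] using h) (by positivity)
    by_cases hw3 : w ≤ A / 3
    · refine ⟨?_, hw3⟩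
      by_contra hlt
      rw [not_le] at hlt
      rcases eq_or_lt_of_le hw3 with heq | hlt3
      · -- w = A/3 > lo contradicts w < lo
        exact absurd (heq ▸ hlo) (not_lt.mpr hlt.le)
      · have h1 : 0 < A - 3 * w := by linarith
        have h2 : w - lo < 0 := by linarith
        nlinarith [mul_pos_of_neg_of_neg (neg_neg_of_pos h1) h2]
    · rw [not_le] at hw3
      have h1 : A - 3 * w < 0 := by linarith
      have h2 : 0 < w - lo := by linarith
      nlinarith [mul_neg_of_neg_of_pos h1 h2]
  · rintro ⟨h1, h2⟩
    have ha : 0 ≤ A - 3 * w := by linarith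
    have hb : 0 ≤ w - lo := by linarith
    positivity

end Summit.Ventures.HSemireg.AggregateCovectorLaw
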